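import Summits.ValiantsHypothesis.ValiantsHypothesis.Theorems.LacunarySymmetroidMatrixDescartesFiniteSectorStampCeilingKThree
import Summits.ValiantsHypothesis.ValiantsHypothesis.Theorems.LacunarySymmetroidMatrixDescartesFiniteSectorRealisable
import Summits.ValiantsHypothesis.ValiantsHypothesis.Theorems.LacunarySymmetroidMatrixDescartesFiniteSectorEtaTwoSix

/-!
# `MatrixDescartes` — line «finite»: the SECTOR ceiling of the `(3,3)` cell BY NAME, `η(3,3) ≤ 14` (`HypRootLawAt 3 3 14`),
# hence `η(3,3) = 14` EXACT on both sides in the kernel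

HONEST FRAMING.  Object-search cell `pub-symmetroid`, seat val-sym-eng-3 g4.  HELPER of the crux item
`stmt-ValiantsHypothesis-18050` (`Theses.LacunarySymmetroid.MatrixDescartes`, asymptotic in `K`) with NO closure claim.
The PROVED gap-rule SIEVE of line «finite» (`…FiniteSector.sieve`, `…natDegree_mem_sumset`; val-idea-6 g3 / port eng-3 g3)
says: if the determinant of a real symmetric `(m,K)` lacunary pencil lies in the sector (all roots real and simple) and has
degree `n`, then `n` is an `m`-fold sum of the exponents and of any two consecutive integers below `n − 1` at least one is.
The card `Lines/finite.md` turned this into the located caps `η(m,K) ≤ σ(m,K)` by enumeration (`instr/stamp.py`).  This file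
proves the `(3,3)` cap in the kernel, uniformly in the support `d : Fin 3 → ℕ`: the sieve at `r = 0` forces an exponent `0`,
so the `3`-fold sums are `{q·x + s·y : q + s ≤ 3}` for the other two exponent values `x, y`; the chain condition at
`r = 1, 4, 7, 8, 12, 13, 15` (a short case analysis on `min(x,y) ≤ 2`, `interval_cases` + `omega`; no `decide`) forces
`n ≤ 14`:  `hypRootLawAt_three_three_14 : HypRootLawAt 3 3 14`.  With the F4 witness doubled
(`fullyRealisable_three_013_seven`, adapter `not_hypRootLawAt_of_fullyRealisable` of door-p5 g7):
`not_hypRootLawAt_three_three_13`, so `η(3,3) = 14` is EXACT on both sides in the kernel.  Nothing here bears on the crux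
or on `VP ≠ VNP`.  [folklore] Elementary additive bookkeeping; no citation is load-bearing.
-/

-- `Summit.ValiantsHypothesis.ValiantsHypothesis.…` repeats a component by the D-0017 layout
-- (single-conjunct summit), which the `dupNamespace` linter flags; the name is mandated.
set_option linter.dupNamespace false

namespace Summit.ValiantsHypothesis.ValiantsHypothesis.Theorems.LacunarySymmetroidMatrixDescartes.FiniteSector

open scoped BigOperators Matrix
open Polynomial

/-! ## §1 The combinatorial core: a step-`≤ 2` chain in `{q·x + s·y : q + s ≤ 3}` stops by `14` -/

/-- Symmetry of «`r = q·x + s·y` with `q + s ≤ 3`» in `x, y`. [folklore] -/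
theorem inS3_comm {x y r : ℕ} (h : ∃ q s : ℕ, q + s ≤ 3 ∧ q * x + s * y = r) :
    ∃ q s : ℕ, q + s ≤ 3 ∧ q * y + s * x = r := by
  obtain ⟨q, s, hqs, h⟩ := h
  exact ⟨s, q, by omega, by rw [← h]; ring⟩

/-- `b ≤ a·b` for `a ≥ 1` (the «a large denomination cannot be used below itself» step). [folklore] -/
theorem self_le_mul_of_one_le {a b : ℕ} (ha : 1 ≤ a) : b ≤ a * b := Nat.le_mul_of_pos_left b ha

/-- Core case `x ≤ 2`: if `n ≥ 15` is a `3`-fold sum of `{0,x,y}` and the sums are `2`-dense below `n − 1`, contradiction. [folklore] -/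
theorem chain33_core (x y n : ℕ) (hx : x ≤ 2) (hn : 15 ≤ n) (hmem : ∃ q s : ℕ, q + s ≤ 3 ∧ q * x + s * y = n)
    (hchain : ∀ r, r + 2 ≤ n → (∃ q s : ℕ, q + s ≤ 3 ∧ q * x + s * y = r) ∨
      (∃ q s : ℕ, q + s ≤ 3 ∧ q * x + s * y = r + 1)) : False := by
  obtain ⟨q0, s0, hqs0, hn0⟩ := hmem
  interval_cases x
  · -- x = 0 : the sums are `s·y`, `s ≤ 3`; the chain at `r = 1` forces `y ≤ 2`, then `n ≤ 6`
    rcases hchain 1 (by omega) with ⟨q, s, hqs, h⟩ | ⟨q, s, hqs, h⟩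
    · rcases Nat.lt_or_ge y 3 with hy | hy
      · interval_cases y <;> omega
      · rcases Nat.eq_zero_or_pos s with hs | hs
        · subst hs; omega
        · have := self_le_mul_of_one_le (b := y) hs; omega
    · rcases Nat.lt_or_ge y 3 with hy | hy
      · interval_cases y <;> omega
      · rcases Nat.eq_zero_or_pos s with hs | hs
        · subst hs; omega
        · have := self_le_mul_of_one_le (b := y) hs; omega
  · -- x = 1 : the chain at `r = 4` forces `y ≤ 5`; then `n ≤ 15` with equality only for `y = 5`, killed at `r = 8`
    have hy : y ≤ 5 := by
      rcases hchain 4 (by omega) with ⟨q, s, hqs, h⟩ | ⟨q, s, hqs, h⟩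
      · rcases Nat.eq_zero_or_pos s with hs | hs
        · subst hs; omega
        · by_contra hy'
          have : y ≤ s * y := self_le_mul_of_one_le hs
          omega
      · rcases Nat.eq_zero_or_pos s with hs | hs
        · subst hs; omega
        · by_contra hy'
          have : y ≤ s * y := self_le_mul_of_one_le hs
          omega
    interval_cases y
    all_goals first
      | omega
      | (rcases hchain 8 (by omega) with ⟨q, s, hqs, h⟩ | ⟨q, s, hqs, h⟩ <;> omega)
  · -- x = 2 : the chain at `r = 7` forces `y ≤ 8`; each `y ≤ 8` dies at `r = 13, 15, 12, 13` resp. (or `n ≤ 14`)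
    have hy : y ≤ 8 := by
      rcases hchain 7 (by omega) with ⟨q, s, hqs, h⟩ | ⟨q, s, hqs, h⟩
      · rcases Nat.eq_zero_or_pos s with hs | hs
        · subst hs; omega
        · by_contra hy'
          have : y ≤ s * y := self_le_mul_of_one_le hs
          omega
      · rcases Nat.eq_zero_or_pos s with hs | hs
        · subst hs; omega
        · by_contra hy'
          have : y ≤ s * y := self_le_mul_of_one_le hs
          omega
    interval_cases y
    all_goals first
      | omega
      | (rcases hchain 13 (by omega) with ⟨q, s, hqs, h⟩ | ⟨q, s, hqs, h⟩ <;> omega)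
      | (rcases hchain 15 (by omega) with ⟨q, s, hqs, h⟩ | ⟨q, s, hqs, h⟩ <;> omega)
      | (rcases hchain 12 (by omega) with ⟨q, s, hqs, h⟩ | ⟨q, s, hqs, h⟩ <;> omega)

/-- **The `(3,3)` sieve bound.**  If `n ≥ 15` is a `3`-fold sum of `{0, x, y}` then the `3`-fold sums are NOT `2`-dense below
`n − 1`. [folklore] -/
theorem chain33 (x y n : ℕ) (hn : 15 ≤ n) (hmem : ∃ q s : ℕ, q + s ≤ 3 ∧ q * x + s * y = n)
    (hchain : ∀ r, r + 2 ≤ n → (∃ q s : ℕ, q + s ≤ 3 ∧ q * x + s * y = r) ∨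
      (∃ q s : ℕ, q + s ≤ 3 ∧ q * x + s * y = r + 1)) : False := by
  rcases Nat.lt_or_ge x 3 with hx | hx
  · exact chain33_core x y n (by omega) hn hmem hchain
  rcases Nat.lt_or_ge y 3 with hy | hy
  · exact chain33_core y x n (by omega) hn (inS3_comm hmem)
      (fun r hr => (hchain r hr).imp inS3_comm inS3_comm)
  -- both `x, y ≥ 3`: `1` and `2` are not sums
  have key : ∀ r, (∃ q s : ℕ, q + s ≤ 3 ∧ q * x + s * y = r) → r = 0 ∨ 3 ≤ r := by
    rintro r ⟨q, s, hqs, h⟩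
    rcases Nat.eq_zero_or_pos q with hq | hq
    · rcases Nat.eq_zero_or_pos s with hs | hs
      · subst hq; subst hs; left; omega
      · have := self_le_mul_of_one_le (b := y) hs; right; omega
    · have := self_le_mul_of_one_le (b := x) hq; right; omega
  rcases hchain 1 (by omega) with h | h
  · rcases key 1 h with h' | h' <;> omega
  · rcases key 2 h with h' | h' <;> omega

/-! ## §2 From the sieve to the three-value structure -/

/-- A multiset of indices all carrying exponent `≥ 1` has `d`-sum `≥` its size. [folklore] -/
theorem card_le_sum_of_forall_pos {K : ℕ} (d : Fin K → ℕ) :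
    ∀ (s : Multiset (Fin K)), (∀ i ∈ s, 1 ≤ d i) → Multiset.card s ≤ (s.map d).sum := by
  intro s
  induction s using Multiset.induction_on with
  | empty => intro _; simp
  | cons i t ih =>
    intro h
    rw [Multiset.map_cons, Multiset.sum_cons, Multiset.card_cons]
    have h1 : 1 ≤ d i := h i (Multiset.mem_cons_self i t)
    have h2 := ih fun j hj => h j (Multiset.mem_cons_of_mem hj)
    omega

/-- A multiset of size `≥ 2` with `d`-sum `≤ 1` contains an index with exponent `0`. [folklore] -/
theorem exists_eq_zero_of_sum_le_one {K : ℕ} (d : Fin K → ℕ) (s : Multiset (Fin K))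
    (hs : 2 ≤ Multiset.card s) (h : (s.map d).sum ≤ 1) : ∃ a, d a = 0 := by
  by_contra hne
  have hpos : ∀ i ∈ s, 1 ≤ d i := fun i _ => by
    by_contra h0
    exact hne ⟨i, by omega⟩
  have := card_le_sum_of_forall_pos d s hpos
  omega

/-- Three indices, one of them with exponent `0`: all exponent values are `0`, `x` or `y`. [folklore] -/
theorem values_fin_three_zero (d : Fin 3 → ℕ) (a : Fin 3) (ha : d a = 0) :
    ∃ x y, ∀ i, d i = 0 ∨ d i = x ∨ d i = y := by
  obtain ⟨c, c', hc⟩ : ∃ c c' : Fin 3, ∀ i : Fin 3, i = a ∨ i = c ∨ i = c' := by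
    fin_cases a
    · exact ⟨1, 2, by decide⟩
    · exact ⟨0, 2, by decide⟩
    · exact ⟨0, 1, by decide⟩
  refine ⟨d c, d c', fun i => ?_⟩
  rcases hc i with h | h | h
  · exact Or.inl (h ▸ ha)
  · exact Or.inr (Or.inl (h ▸ rfl))
  · exact Or.inr (Or.inr (h ▸ rfl))

/-- With the exponent values among `{0, x, y}`, every multiset sum of exponents is `q·x + s·y` with `q + s ≤ card`. [folklore] -/
theorem sum_eq_stamps_zero {K : ℕ} (d : Fin K → ℕ) (x y : ℕ) (hd : ∀ i, d i = 0 ∨ d i = x ∨ d i = y) :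
    ∀ (s : Multiset (Fin K)), ∃ q r : ℕ, q + r ≤ Multiset.card s ∧ (s.map d).sum = q * x + r * y := by
  intro s
  induction s using Multiset.induction_on with
  | empty => exact ⟨0, 0, by simp, by simp⟩
  | cons i t ih =>
    obtain ⟨q, r, hqr, hsum⟩ := ih
    rw [Multiset.map_cons, Multiset.sum_cons, Multiset.card_cons, hsum]
    rcases hd i with h | h | h
    · exact ⟨q, r, by omega, by rw [h]; ring⟩
    · exact ⟨q + 1, r, by omega, by rw [h]; ring⟩
    · exact ⟨q, r + 1, by omega, by rw [h]; ring⟩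

/-! ## §3 The rows by name -/

/-- **`η(3,3) ≤ 14 = σ(3,3)`** (`HypRootLawAt 3 3 14`): every real symmetric `3 × 3` lacunary pencil with `3` terms whose
determinant lies in the sector (all roots real and simple) has determinant degree `≤ 14` — for ALL supports
`d : Fin 3 → ℕ`. [folklore] -/
theorem hypRootLawAt_three_three_14 : HypRootLawAt 3 3 14 := by
  intro d S hS hsec
  by_contra hdeg'
  have hdeg : 14 < (pencil d S).det.natDegree := not_le.mp hdeg'
  have hq : (pencil d S).det ≠ 0 := by
    intro h0
    rw [h0] at hdeg
    simp at hdeg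
  -- sieve and top, in multiset form
  have himage : ∀ r, r ∈ (Finset.univ : Finset (Sym (Fin 3) 3)).image
      (fun s : Sym (Fin 3) 3 => ((s : Multiset (Fin 3)).map d).sum) →
      ∃ s : Multiset (Fin 3), Multiset.card s = 3 ∧ (s.map d).sum = r := by
    intro r hr
    rw [Finset.mem_image] at hr
    obtain ⟨s, -, hs⟩ := hr
    exact ⟨(s : Multiset (Fin 3)), s.2, hs⟩
  have hsieve : ∀ r, r + 2 ≤ (pencil d S).det.natDegree →
      (∃ s : Multiset (Fin 3), Multiset.card s = 3 ∧ (s.map d).sum = r) ∨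
      (∃ s : Multiset (Fin 3), Multiset.card s = 3 ∧ (s.map d).sum = r + 1) := by
    intro r hr
    rcases sieve d S hq hsec hr with h | h
    · exact Or.inl (himage r h)
    · exact Or.inr (himage (r + 1) h)
  have htop := himage _ (natDegree_mem_sumset d S hq)
  -- an exponent `0` (sieve at `r = 0`)
  obtain ⟨a, ha⟩ : ∃ a, d a = 0 := by
    rcases hsieve 0 (by omega) with ⟨s, hsc, hs⟩ | ⟨s, hsc, hs⟩
    · exact exists_eq_zero_of_sum_le_one d s (by omega) (by omega)
    · exact exists_eq_zero_of_sum_le_one d s (by omega) (by omega)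
  obtain ⟨x, y, hxy⟩ := values_fin_three_zero d a ha
  -- translate to two-denomination sums
  have hIn : ∀ r, (∃ s : Multiset (Fin 3), Multiset.card s = 3 ∧ (s.map d).sum = r) →
      ∃ q t : ℕ, q + t ≤ 3 ∧ q * x + t * y = r := by
    rintro r ⟨s, hsc, hs⟩
    obtain ⟨q, t, hqt, hsum⟩ := sum_eq_stamps_zero d x y hxy s
    exact ⟨q, t, by omega, by omega⟩
  have hdeg2 : 15 ≤ (Matrix.det (∑ l, ((Polynomial.X : ℝ[X]) ^ d l) • (S l).map Polynomial.C)).natDegree := hdeg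
  exact chain33 x y _ hdeg2 (hIn _ htop) (fun r hr => (hsieve r hr).imp (hIn r) (hIn (r + 1)))

/-- **`η(3,3) ≥ 14`**: `¬ HypRootLawAt 3 3 13` — the doubled F4 realisation (`fullyRealisable_three_013_seven`; adapter
`not_hypRootLawAt_of_fullyRealisable`): an in-sector `(3,3)` pencil on `(0,2,6)` of degree `14`. [folklore] -/
theorem not_hypRootLawAt_three_three_13 : ¬ HypRootLawAt 3 3 13 :=
  not_hypRootLawAt_of_fullyRealisable fullyRealisable_three_013_seven (by norm_num)

end Summit.ValiantsHypothesis.ValiantsHypothesis.Theorems.LacunarySymmetroidMatrixDescartes.FiniteSector
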